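import Summits.SmoothPoincare4.SmoothPoincare4.Theses.DottedCircleRasmussen
import Summits.SmoothPoincare4.SmoothPoincare4.Theorems.DottedCircleRasmussenDcrGfgmw
import Summits.SmoothPoincare4.SmoothPoincare4.Theorems.DcrGap.Negative.NoDiscNormalForm
import Summits.SmoothPoincare4.SmoothPoincare4.Theorems.DcrGap.Negative.KZeroIsFgmw
import Literature.Topology.FourManifolds.MMSWRasmussenFactsProofs
import Literature.Topology.FourManifolds.ChartTransport
import Literature.Topology.FourManifolds.SliceRibbon
import Literature.Topology.FourManifolds.KnotsProofs
import Literature.Topology.FourManifolds.HomotopyBallSliceSphereProofs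

/-!
# `DcrRigidity` — negative side II: load-bearing analysis of the kill switch

Support lemmas for the crux `Summit.SmoothPoincare4.SmoothPoincare4.Theses.DottedCircleRasmussen.DcrRigidity`
(stmt-SmoothPoincare4-17014, `DcrRigidity := ¬ DcrGap`, route `DottedCircleRasmussen`), from the
standing disprover's work file `Cruxes/DcrRigidity/Disproof.lean` (theorems only; nothing here
concludes the crux or any route item positively — every statement about the crux is about
`¬ DcrGap` restated, or an equivalence).

Read as a `∀`-statement (landed `DcrGap.Negative.dcrRigidity_iff_modelForm`) the kill switch is

  `∀ k K, IsModelKnot k K → (K slice off e(D_k) in SOME homotopy 4-sphere M) →`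
  `(K slice off e'(D_k) in SOME N ≅ S⁴)`  — equivalently `∃` a MODEL slice disc in `ℝ⁴ ∖ D_k`.

Which of its hypotheses carry weight?  (The disprover's mutation pass, as theorems.)

* `isModelKnot_of_isSliceDiscInComplement` — the REGULARITY clauses of `IsModelKnot` (smooth,
  injective, immersed) are IMPLIED by any slice datum: `K = e⁻¹ ∘ f|_{S¹}` with `e` a diffeomorphism
  onto an open set.  Only the MEMBERSHIP clause `K ⊂ ∂D_k` is independent, and it is used by the
  proofs only through `K ⊂ B̄(0, 40(k+1)+1)`.  Hence `not_dcrGap_iff_membershipOnly`: the kill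
  switch with `IsModelKnot k K` weakened to membership is the SAME statement.
* `exists_up_to_homotopyEquiv` — weakening the CONCLUSION's `N ≃ₘ S⁴` to `N ≃ₕ S⁴` makes the
  statement trivially true (`N := M`): all content sits in the smooth structure of `N` (dual of
  the landed `DcrGap.Negative.dcrGap_false_without_diffeo`).
* `not_dcrGap_iff_roundChart` — STRENGTHENING the conclusion to the literal `S⁴` with THE round
  chart `(chartAt a)⁻¹` (no freedom in carrier, atlas, chart or chirality) is still the same
  statement (Palais standardisation, landed normal form + `IsModelSliceDisc.isSliceDiscInComplement_chartAt_symm`).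
* `exists_isModelKnot_zero_slice` — NON-VACUITY: the hypothesis class is inhabited already at
  `k = 0` (the unknot, rescaled onto the ellipsoid `∂D_0`, with its flat disc pushed into `S⁴`;
  tree: `isSmoothlySlice_unknot`, `Knot.IsSmoothlySlice.isHomotopyBallSlice_holds`, and the
  landed `k = 0` dictionary of `KZeroIsFgmw.lean`), so the kill switch is not true for want of data:
  a proof must produce discs, a disproof must produce a datum with NO model disc.
* The two hypotheses that DO carry weight — `M ≃ₕ S⁴` on the carrier of the datum, and
  `f(𝔻°) ∩ e(D_k) = ∅` — cannot be certified load-bearing inside the tree today: dropping either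
  makes the statement false in print (a trefoil in a 3-ball of `∂D_k` is slice off `D_k` in
  `M = S² × S² ∖ pt`-type carriers by Norman's trick, resp. bounds a disc THROUGH `D_k` in `S⁴`,
  but is not slice in `♮ᵏ(B² × S²)` by MMSW Lemma 8.19, `s = 2`), and no slice OBSTRUCTION in
  `♮ᵏ(B² × S²)` is formalised (recorded in the work file as near-misses, not here).

References: R. Palais, Proc. AMS 11 (1960), Thm. B [Palais1960]; C. Manolescu, M. Marengon,
S. Sarkar, M. Willis, Duke Math. J. 172 (2023), Def. 8.14, Lemma 8.19 [ManolescuMarengonSarkarWillis2023];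
C. Manolescu, L. Piccirillo, J. Lond. Math. Soc. 108 (2023), §2 [ManolescuPiccirillo2023].
-/

noncomputable section

-- The namespace is prescribed by the crux protocol (`Summit.<P>.<Sub>.Theorems.<Crux>.Negative`
-- with `P = Sub = SmoothPoincare4`), hence the duplicated component.
set_option linter.dupNamespace false

open scoped Manifold ContDiff Topology
open Function Set Metric Module
open Literature.Topology.FourManifolds Literature.Topology.FourManifolds.MMSW
open Summit.SmoothPoincare4.SmoothPoincare4.Theses.DottedCircleRasmussen

namespace Summit.SmoothPoincare4.SmoothPoincare4.Theorems.DcrRigidity.Negative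

/-! ## §1 The regularity clauses of `IsModelKnot` are implied by the datum -/

section Datum

variable {X : Type*} [TopologicalSpace X] [ChartedSpace (EuclideanSpace ℝ (Fin 4)) X] {k : ℕ}
  {K : (Metric.sphere (0 : EuclideanSpace ℝ (Fin 2)) 1) → EuclideanSpace ℝ (Fin 4)}
  {e : EuclideanSpace ℝ (Fin 4) → X} {f : EuclideanSpace ℝ (Fin 2) → X}

/-- **A circle carrying a slice datum is automatically a smooth embedded circle.** If `(e, f)` is
a slice datum for `K` (`MMSW.IsSliceDiscInComplement k K X e f`: `e` a smooth chart `ℝ⁴ ↪ X`,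
`f|_{𝔻²}` a smooth embedded disc with `f|_{S¹} = e ∘ K`), then `K` is `C^∞`, injective and immersed:
`K = Φ ∘ f|_{S¹}` for the smooth inverse `Φ` of `e` on its open range
(`exists_chart_of_isSmoothEmbedding`), `f` is injective on `S¹ ⊂ 𝔻²`, and
`de ∘ dK = d(f|_{S¹}) = df ∘ d(incl)` is injective. With membership `K ⊂ ∂D_k` this is
`IsModelKnot k K`. [folklore] -/
theorem isModelKnot_of_isSliceDiscInComplement [IsManifold (𝓡 4) ∞ X]
    (h : IsSliceDiscInComplement k K X e f) (hK : ∀ t, K t ∈ modelBoundary k) :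
    IsModelKnot k K := by
  obtain ⟨he, hf, hinj, hmf, -, hbdry⟩ := h
  obtain ⟨Φ, hΦt, hΦe, hΦs, hΦc⟩ := exists_chart_of_isSmoothEmbedding he
  haveI : Fact (finrank ℝ (EuclideanSpace ℝ (Fin 2)) = 1 + 1) := ⟨finrank_euclideanSpace_fin⟩
  have hval : ContMDiff (𝓡 1) (𝓡 2) ∞
      (fun t : Metric.sphere (0 : EuclideanSpace ℝ (Fin 2)) 1 => (t : EuclideanSpace ℝ (Fin 2))) :=
    contMDiff_coe_sphere
  have hfv : ContMDiff (𝓡 1) (𝓡 4) ∞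
      (fun t : Metric.sphere (0 : EuclideanSpace ℝ (Fin 2)) 1 => f t) := hf.comp hval
  have hsrc : ∀ t : Metric.sphere (0 : EuclideanSpace ℝ (Fin 2)) 1, f t ∈ Φ.source := fun t => by
    rw [hΦs, hbdry t]
    exact ⟨K t, rfl⟩
  have hKeq : ∀ t : Metric.sphere (0 : EuclideanSpace ℝ (Fin 2)) 1, Φ (f t) = K t := fun t => by
    rw [hbdry t, ← hΦe]
    exact Φ.right_inv (by rw [hΦt]; exact mem_univ _)
  have hKs : ContMDiff (𝓡 1) 𝓘(ℝ, EuclideanSpace ℝ (Fin 4)) ∞ K :=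
    (hΦc.comp_contMDiff hfv hsrc).congr fun t => (hKeq t).symm
  have hKinj : Injective K := fun t₁ t₂ ht => by
    have h1 : f t₁ = f t₂ := by rw [hbdry, hbdry, ht]
    exact Subtype.ext (hinj (sphere_subset_closedBall t₁.2) (sphere_subset_closedBall t₂.2) h1)
  refine ⟨hKs, hKinj, fun t => ?_, hK⟩
  have hcomp : (fun t : Metric.sphere (0 : EuclideanSpace ℝ (Fin 2)) 1 => f t) = e ∘ K :=
    funext fun t => hbdry t
  have h1 : MDifferentiableAt (𝓡 1) 𝓘(ℝ, EuclideanSpace ℝ (Fin 4)) K t :=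
    hKs.mdifferentiableAt (by simp)
  have h2 : MDifferentiableAt 𝓘(ℝ, EuclideanSpace ℝ (Fin 4)) (𝓡 4) e (K t) :=
    he.contMDiff.mdifferentiableAt (by simp)
  have h3 : MDifferentiableAt (𝓡 1) (𝓡 2)
      (fun t : Metric.sphere (0 : EuclideanSpace ℝ (Fin 2)) 1 => (t : EuclideanSpace ℝ (Fin 2))) t :=
    hval.mdifferentiableAt (by simp)
  have h4 : MDifferentiableAt (𝓡 2) (𝓡 4) f (t : EuclideanSpace ℝ (Fin 2)) :=
    hf.mdifferentiableAt (by simp)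
  have key : Injective (mfderiv (𝓡 1) (𝓡 4) (e ∘ K) t) := by
    rw [← hcomp, show (fun t : Metric.sphere (0 : EuclideanSpace ℝ (Fin 2)) 1 => f t) =
      f ∘ (fun t : Metric.sphere (0 : EuclideanSpace ℝ (Fin 2)) 1 => (t : EuclideanSpace ℝ (Fin 2)))
      from rfl, mfderiv_comp t h4 h3]
    exact (hmf _ (sphere_subset_closedBall t.2)).comp
      (mfderiv_coe_sphere_injective (E := EuclideanSpace ℝ (Fin 2)) (n := 1) t)
  rw [mfderiv_comp t h2 h1] at key
  intro v w hvw
  apply key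
  change (mfderiv 𝓘(ℝ, EuclideanSpace ℝ (Fin 4)) (𝓡 4) e (K t))
      ((mfderiv (𝓡 1) 𝓘(ℝ, EuclideanSpace ℝ (Fin 4)) K t) v) =
    (mfderiv 𝓘(ℝ, EuclideanSpace ℝ (Fin 4)) (𝓡 4) e (K t))
      ((mfderiv (𝓡 1) 𝓘(ℝ, EuclideanSpace ℝ (Fin 4)) K t) w)
  rw [hvw]

/-- **Weakening the conclusion to homotopy equivalence makes the kill switch trivially true**:
given a datum in a homotopy sphere `M`, the carrier `N := M` itself is "some `N ≃ₕ S⁴` with a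
datum". So all content of the kill switch sits in the DIFFEOMORPHISM `N ≃ₘ S⁴` of its conclusion
(dual of the landed `DcrGap.Negative.dcrGap_false_without_diffeo`). [folklore] -/
theorem exists_up_to_homotopyEquiv (k : ℕ)
    (K : (Metric.sphere (0 : EuclideanSpace ℝ (Fin 2)) 1) → EuclideanSpace ℝ (Fin 4))
    (M : Type) [TopologicalSpace M] [T2Space M] [SecondCountableTopology M]
    [ChartedSpace (EuclideanSpace ℝ (Fin 4)) M] [IsManifold (𝓡 4) ∞ M]
    (hM : Nonempty (ContinuousMap.HomotopyEquiv M (Metric.sphere (0 : EuclideanSpace ℝ (Fin 5)) 1)))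
    (e : EuclideanSpace ℝ (Fin 4) → M) (f : EuclideanSpace ℝ (Fin 2) → M)
    (h : IsSliceDiscInComplement k K M e f) :
    ∃ (N : Type) (_ : TopologicalSpace N) (_ : T2Space N) (_ : SecondCountableTopology N)
      (_ : ChartedSpace (EuclideanSpace ℝ (Fin 4)) N) (_ : IsManifold (𝓡 4) ∞ N),
      Nonempty (ContinuousMap.HomotopyEquiv N (Metric.sphere (0 : EuclideanSpace ℝ (Fin 5)) 1)) ∧
        ∃ (e' : EuclideanSpace ℝ (Fin 4) → N) (f' : EuclideanSpace ℝ (Fin 2) → N),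
          IsSliceDiscInComplement k K N e' f' :=
  ⟨M, _, ‹_›, ‹_›, _, ‹_›, hM, e, f, h⟩

end Datum

/-! ## §2 The kill switch with `IsModelKnot` weakened to membership is the same statement -/

/-- **Only the membership clause of `IsModelKnot` is independent**: `¬ DcrGap` (the kill switch,
in the landed normal form) is EQUIVALENT to its version for arbitrary maps `K : S¹ → ∂D_k` — the
regularity clauses come for free with the datum (`isModelKnot_of_isSliceDiscInComplement`).
Information for provers: nothing is gained or lost by the smooth/injective/immersed hypotheses.
[folklore] -/
theorem not_dcrGap_iff_membershipOnly :
    ¬ DcrGap ↔ ∀ (k : ℕ)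
      (K : (Metric.sphere (0 : EuclideanSpace ℝ (Fin 2)) 1) → EuclideanSpace ℝ (Fin 4)),
      (∀ t, K t ∈ modelBoundary k) →
      (∃ (M : Type) (_ : TopologicalSpace M) (_ : T2Space M) (_ : SecondCountableTopology M)
          (_ : ChartedSpace (EuclideanSpace ℝ (Fin 4)) M) (_ : IsManifold (𝓡 4) ∞ M),
          Nonempty (ContinuousMap.HomotopyEquiv M (Metric.sphere (0 : EuclideanSpace ℝ (Fin 5)) 1)) ∧
            ∃ (e : EuclideanSpace ℝ (Fin 4) → M) (f : EuclideanSpace ℝ (Fin 2) → M),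
              IsSliceDiscInComplement k K M e f) →
      ∃ g, IsModelSliceDisc k K g := by
  rw [DcrGap.Negative.dcrRigidity_iff_modelForm]
  refine forall₂_congr fun k K => ⟨fun h hK hS => ?_, fun h hK hS => h hK.mem hS⟩
  obtain ⟨M, _, _, _, _, _, hM, e, f, hef⟩ := hS
  exact h (isModelKnot_of_isSliceDiscInComplement hef hK) ⟨M, _, ‹_›, ‹_›, _, ‹_›, hM, e, f, hef⟩

/-! ## §3 Strengthening the conclusion to the round chart of the literal `S⁴` changes nothing -/

/-- **No freedom of the conclusion is exploitable, in either direction**: `¬ DcrGap` is equivalent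
to the version whose conclusion names the literal unit sphere `S⁴ ⊂ ℝ⁵`, its Mathlib atlas and
THE round chart `(chartAt a)⁻¹` at a fixed point `a` — a datum `((chartAt a)⁻¹, f')`. (`→`: the
model slice disc of the normal form pushed along the round chart,
`IsModelSliceDisc.isSliceDiscInComplement_chartAt_symm`; `←`: a datum in `S⁴` with any chart is
standardised, landed `DcrGap.Negative.noDisc_iff_forall_not_isModelSliceDisc`.)
[cite: Palais1960, Thm. B] -/
theorem not_dcrGap_iff_roundChart (a : Metric.sphere (0 : EuclideanSpace ℝ (Fin 5)) 1) :
    ¬ DcrGap ↔ ∀ (k : ℕ)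
      (K : (Metric.sphere (0 : EuclideanSpace ℝ (Fin 2)) 1) → EuclideanSpace ℝ (Fin 4)),
      IsModelKnot k K →
      (∃ (M : Type) (_ : TopologicalSpace M) (_ : T2Space M) (_ : SecondCountableTopology M)
          (_ : ChartedSpace (EuclideanSpace ℝ (Fin 4)) M) (_ : IsManifold (𝓡 4) ∞ M),
          Nonempty (ContinuousMap.HomotopyEquiv M (Metric.sphere (0 : EuclideanSpace ℝ (Fin 5)) 1)) ∧
            ∃ (e : EuclideanSpace ℝ (Fin 4) → M) (f : EuclideanSpace ℝ (Fin 2) → M),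
              IsSliceDiscInComplement k K M e f) →
      ∃ f' : EuclideanSpace ℝ (Fin 2) → Metric.sphere (0 : EuclideanSpace ℝ (Fin 5)) 1,
        IsSliceDiscInComplement k K (Metric.sphere (0 : EuclideanSpace ℝ (Fin 5)) 1)
          (chartAt (EuclideanSpace ℝ (Fin 4)) a).symm f' := by
  rw [DcrGap.Negative.dcrRigidity_iff_modelForm]
  refine forall₂_congr fun k K => imp_congr_right fun hK => imp_congr_right fun _ => ⟨?_, ?_⟩
  · rintro ⟨g, hg⟩
    exact ⟨_, hg.isSliceDiscInComplement_chartAt_symm a⟩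
  · rintro ⟨f', hf'⟩
    by_contra hno
    push Not at hno
    exact DcrGap.Negative.noDisc_of_forall_not_isModelSliceDisc hK.mem hno _
      ⟨Diffeomorph.refl _ _ _⟩ _ _ hf'

/-! ## §4 Non-vacuity: the hypothesis class is inhabited at `k = 0` -/

/-- **The kill switch is not vacuously true**: already with no dotted circle there is a model knot
with a slice datum in a homotopy 4-sphere — the unknot rescaled onto the ellipsoid `∂D_0 = L(S³)`,
`L = diag(40, 40, 1, 1)` (landed `DcrGap.Negative.exists_scaling`, `isModelKnot_scaling_comp`),
whose flat slice disc pushed into `S⁴` (`isSmoothlySlice_unknot`,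
`Knot.IsSmoothlySlice.isHomotopyBallSlice_holds`) is a `k = 0` datum by the landed dictionary
`isSliceDiscInComplement_zero_of_isSliceDiscIn`. [cite: ManolescuPiccirillo2023, §2] -/
theorem exists_isModelKnot_zero_slice :
    ∃ K : (Metric.sphere (0 : EuclideanSpace ℝ (Fin 2)) 1) → EuclideanSpace ℝ (Fin 4),
      IsModelKnot 0 K ∧
      ∃ (M : Type) (_ : TopologicalSpace M) (_ : T2Space M) (_ : SecondCountableTopology M)
        (_ : ChartedSpace (EuclideanSpace ℝ (Fin 4)) M) (_ : IsManifold (𝓡 4) ∞ M),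
        Nonempty (ContinuousMap.HomotopyEquiv M (Metric.sphere (0 : EuclideanSpace ℝ (Fin 5)) 1)) ∧
          ∃ (e : EuclideanSpace ℝ (Fin 4) → M) (f : EuclideanSpace ℝ (Fin 2) → M),
            IsSliceDiscInComplement 0 K M e f := by
  obtain ⟨L, hL⟩ := DcrGap.Negative.exists_scaling
  have hD := DcrGap.Negative.scaling_mem_modelHandlebody_zero_iff hL
  obtain ⟨M, _, _, _, _, _, _, hM, e, f, hef⟩ :=
    Knot.IsSmoothlySlice.isHomotopyBallSlice_holds unknot isSmoothlySlice_unknot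
  exact ⟨_, DcrGap.Negative.isModelKnot_scaling_comp hL unknot, M, _, ‹_›, ‹_›, _, ‹_›, hM, _, f,
    DcrGap.Negative.isSliceDiscInComplement_zero_of_isSliceDiscIn hD hef⟩

/-- **… hence any proof of the kill switch must PRODUCE model slice discs** (it cannot hold for
want of hypotheses), and dually a disproof must produce a datum with NO model slice disc — for
the `k = 0` datum above the flat disc is one, so the unknot is never a witness
(landed `DcrGap.Negative.not_noDisc_of_isModelSliceDisc`). Stated: the normal form's hypothesis
is met at least once. [folklore] -/
theorem exists_hypotheses_of_modelForm :
    ∃ (k : ℕ) (K : (Metric.sphere (0 : EuclideanSpace ℝ (Fin 2)) 1) → EuclideanSpace ℝ (Fin 4)),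
      IsModelKnot k K ∧
      ∃ (M : Type) (_ : TopologicalSpace M) (_ : T2Space M) (_ : SecondCountableTopology M)
        (_ : ChartedSpace (EuclideanSpace ℝ (Fin 4)) M) (_ : IsManifold (𝓡 4) ∞ M),
        Nonempty (ContinuousMap.HomotopyEquiv M (Metric.sphere (0 : EuclideanSpace ℝ (Fin 5)) 1)) ∧
          ∃ (e : EuclideanSpace ℝ (Fin 4) → M) (f : EuclideanSpace ℝ (Fin 2) → M),
            IsSliceDiscInComplement k K M e f :=
  ⟨0, exists_isModelKnot_zero_slice⟩

end Summit.SmoothPoincare4.SmoothPoincare4.Theorems.DcrRigidity.Negative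

end
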